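import Summits.CriticalPhenomena.PercolationContinuityZ3.Theorems.Transplant.FKDoubleFanOneSided
import Summits.CriticalPhenomena.PercolationContinuityZ3.Theorems.Transplant.FKDoubleFanCrossApexRoof
import Summits.CriticalPhenomena.PercolationContinuityZ3.Theorems.Transplant.FKThreeApexUCondRimStep
import HarnessLib

/-!
# Double fans, one-sided far pairs: the POLYNOMIAL ROOF PARAMETRISATION, `fanPhi` through the HAT-PRODUCT VECTORS of the outer legs, and the
# three shapes of the fan leg (degenerate / floor / roof)

Helper file (`--supports stmt-CriticalPhenomena-4575`), FK sub-lane `prim-bschramm-fk-3` (gen 32); builds on p205010 (kernel theorem, internal audit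
signed; external expert review pending).  Pure real algebra, no sorries; standard axioms.  Memo `bschramm/prim-bschramm-fk-3/FAR-CROSS-VII.md` §1–§2.

(1) ROOF PARAMETRISATION.  A `U`-tight ("roof") point of the apex-`b` frame with tight probe `w` is `roofV q κ l t w = vecB q (l(1+qt)) (lt) (κ·xw(w))
(κ·zw(w)) (κ·u₀(t,w))` with `xw = (1−w)(2−q−qw)`, `zw = w(2−2q+qw)`, `u₀ = (2−q)t + 2w(1−w)` (the direction relation of `…CrossApexRoof` is `X·zw = Z·xw`,
`dirRel_eq`; the tightness relation then gives `u₀`, `dProfile_eq`; the existence statement is in `…OneSidedRays`).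
(2) PRODUCT VECTORS.  `fanPhi q F u s` depends on `u` only through the six hat products `(ûv̂, x̂v̂, ŷẑ, x̂ŷ, ẑv̂, ûŷ) = uprods u` and on `s` only
through `sprods s = uprods (swapAB s)`, LINEARLY in each: `fanPhi q F u s = fanPhiP q F (uprods u) (sprods s)` (**`fanPhi_eq_P`**).  The product vectors
of the three endpoint shapes of a leg are: degenerate frame `= (u₀y)·𝟙` (**`uprods_deg`**), floor point `= X(W−qy)·A + Xy·AC + Z(W−qy)·D + Zy·BD` with the
four RAYS `A = e_{xv}`, `D = e_{zv}`, `AC = e_{xv}+e_{xy}`, `BD = e_{yz}+e_{zv}` (**`uprods_floor`**), roof point `= κl·roofP q t w` (**`uprods_roofV`**).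
(3) FAN LEG.  Degenerate fan vector: `(1−q)·N(P)·N(S)·f₀(f₀+f_ab)` (**`fanPhiP_degF`**); floor fan vector `(0, f_ab, f_ac, f_bc, f₁)`: decomposition over the
bilinear forms `condA, condN, condC1, condC2` (**`fanPhiP_floorF`**); roof fan vector: `κl·roofF q t w P S`, `roofF = xw·Φ_X + zw·Φ_Z + u₀·Φ₀`
(**`fanPhiP_roofF`**), `Φ_X = (1−q)condN + t·condC2`, `Φ_Z = (1−q)condA + t·condC1`, `Φ₀ = t(1−q)N(P)N(S) + condC10` (`condC10`, the `Z₁Z₀` Gram entry, is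
the only sign-indefinite ingredient).  **`GoodPS q P S`** packages the resulting six conditions on a pair of product vectors.
[folklore]
-/

noncomputable section

namespace Summit.CriticalPhenomena.PercolationContinuityZ3.Theorems

namespace FK

namespace ThreeApex

/-! ### The polynomial roof parametrisation -/

/-- `xw(w) = (1−w)(2−q−qw)` — the `X = Z_ab` profile of a roof point with tight probe `w` (per unit `κ`). [folklore] -/
def xwR (q w : ℝ) : ℝ := (1 - w) * (2 - q - q * w)

/-- `zw(w) = w(2−2q+qw)` — the `Z = Z_bc` profile of a roof point with tight probe `w` (per unit `κ`). [folklore] -/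
def zwR (q w : ℝ) : ℝ := w * (2 - 2 * q + q * w)

/-- `u₀(t,w) = (2−q)t + 2w(1−w)` — the fibre coordinate `Z_0` of a roof point (per unit `κ`), `t = y/(W−qy)`. [folklore] -/
def u0R (q t w : ℝ) : ℝ := (2 - q) * t + 2 * w * (1 - w)

/-- The roof point with scales `κ, l`, ratio `t` and tight probe `w`: `W = l(1+qt)`, `y = lt`, `X = κ·xw`, `Z = κ·zw`, `u₀ = κ·u₀(t,w)`. [folklore] -/
def roofV (q κ l t w : ℝ) : V5 := vecB q (l * (1 + q * t)) (l * t) (κ * xwR q w) (κ * zwR q w) (κ * u0R q t w)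

/-- `xw + zw = (2−q) − 2q w(1−w) > 0` for `q < 4/3`. [folklore] -/
theorem xwR_add_zwR (q w : ℝ) : xwR q w + zwR q w = (2 - q) - 2 * q * (w * (1 - w)) := by
  simp only [xwR, zwR]; ring

/-- `xw + zw > 0` for `0 ≤ q < 1`. [folklore] -/
theorem xwR_add_zwR_pos {q w : ℝ} (hq0 : 0 ≤ q) (hq1 : q < 1) : 0 < xwR q w + zwR q w := by
  rw [xwR_add_zwR]
  have h4 : w * (1 - w) ≤ 1 / 4 := by nlinarith [sq_nonneg (2 * w - 1)]
  nlinarith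

/-- `xw(w) ≥ 0` on `[0,1]` (`q ≤ 1`). [folklore] -/
theorem xwR_nonneg {q w : ℝ} (hq1 : q ≤ 1) (hw0 : 0 ≤ w) (hw1 : w ≤ 1) : 0 ≤ xwR q w := by
  have : 0 ≤ 2 - q - q * w := by nlinarith
  exact mul_nonneg (sub_nonneg.2 hw1) this

/-- `zw(w) ≥ 0` on `[0,1]` (`q ≤ 1`). [folklore] -/
theorem zwR_nonneg {q w : ℝ} (hq1 : q ≤ 1) (hw0 : 0 ≤ w) (hw1 : w ≤ 1) : 0 ≤ zwR q w := by
  have : 0 ≤ 2 - 2 * q + q * w := by nlinarith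
  exact mul_nonneg hw0 this

/-- `u₀(t,w) ≥ 0` for `t ≥ 0`, `w ∈ [0,1]` (`q ≤ 2`). [folklore] -/
theorem u0R_nonneg {q t w : ℝ} (hq2 : q ≤ 2) (ht : 0 ≤ t) (hw0 : 0 ≤ w) (hw1 : w ≤ 1) : 0 ≤ u0R q t w := by
  have := sub_nonneg.2 hw1
  have : 0 ≤ 2 - q := by linarith
  simp only [u0R]; positivity

/-- The direction relation is `X·zw(w) = Z·xw(w)`. [folklore] -/
theorem dirRel_eq (q X Z w : ℝ) :
    q * (X - Z) * w ^ 2 + 2 * ((1 - q) * X + Z) * w - (2 - q) * Z = X * zwR q w - Z * xwR q w := by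
  simp only [xwR, zwR]; ring

/-- `w²·xw + (1−w)²·zw = 2w(1−w)·N(w)`, `N = (1−q) + qw(1−w)`. [folklore] -/
theorem dProfile_eq (q w : ℝ) : w ^ 2 * xwR q w + (1 - w) ^ 2 * zwR q w = 2 * w * (1 - w) * ((1 - q) + q * w * (1 - w)) := by
  simp only [xwR, zwR]; ring

/-! ### Product vectors -/

/-- A vector of the six hat products `(ûv̂, x̂v̂, ŷẑ, x̂ŷ, ẑv̂, ûŷ)` of a leg, read in the apex-`b` frame (for the `s`-leg the same slots hold
`(û'v̂', x̂'v̂', ŷ'ẑ', x̂'ẑ', ŷ'v̂', û'ẑ')`, i.e. the products of `swapAB s`). [folklore] -/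
@[ext] structure P6 where
  /-- `ûv̂` -/
  uv : ℝ
  /-- `x̂v̂` -/
  xv : ℝ
  /-- `ŷẑ` -/
  yz : ℝ
  /-- `x̂ŷ` -/
  xy : ℝ
  /-- `ẑv̂` -/
  zv : ℝ
  /-- `ûŷ` -/
  uy : ℝ

namespace P6

/-- Scalar multiple. [folklore] -/
def smul (c : ℝ) (P : P6) : P6 := ⟨c * P.uv, c * P.xv, c * P.yz, c * P.xy, c * P.zv, c * P.uy⟩

/-- Sum. [folklore] -/
def add (P Q : P6) : P6 := ⟨P.uv + Q.uv, P.xv + Q.xv, P.yz + Q.yz, P.xy + Q.xy, P.zv + Q.zv, P.uy + Q.uy⟩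

end P6

/-- The hat products of a vector (apex-`b` frame). [folklore] -/
def uprods (u : V5) : P6 := ⟨u.z0 * u.total, hx u * u.total, hy u * hz u, hx u * hy u, hz u * u.total, u.z0 * hy u⟩

/-- The hat products of the suffix in the slots of `fanPhiP`: `sprods s = uprods (swapAB s)`. [folklore] -/
def sprods (s : V5) : P6 := ⟨s.z0 * s.total, hx s * s.total, hy s * hz s, hx s * hz s, hy s * s.total, s.z0 * hz s⟩

/-- `sprods = uprods ∘ swapAB`. [folklore] -/
theorem sprods_eq (s : V5) : sprods s = uprods (swapAB s) := by
  ext <;> simp only [sprods, uprods, swapAB, hx, hy, hz, V5.total] <;> ring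

/-- **`fanPhi` as a function of the two product vectors** (literal transcription of `fanPhi`). [folklore] -/
def fanPhiP (q : ℝ) (F : V5) (P S : P6) : ℝ :=
  (1 - q) * (P.xv * S.xv + (1 - q) * P.yz * S.yz - (2 - q) * P.uv * S.uv) * (F.zac ^ 2 + F.zac * F.z1 + F.zac * F.zbc) +
    (1 - q) * (P.zv - (2 - q) * P.uv + (1 - q) * P.xy) *
      ((S.zv - (2 - q) * S.uv + (1 - q) * S.xy) * (F.z0 ^ 2 + F.z0 * F.zab) + S.zv * (F.zbc ^ 2 + F.z1 * F.zbc + F.zac * F.zbc) +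
        (2 * S.zv - (2 - q) * S.uv) * F.z0 * F.zbc) +
    F.zac * F.z0 * (-(1 - q) * (2 - q) * (P.zv - (1 - q) * P.uv) * S.uv + (1 - q) * (P.zv - (2 - q) * P.uv + (1 - q) * P.xy) * S.zv +
        (1 - q) ^ 2 * (2 - q) * (P.uy - P.yz) * S.uy + (1 - q) ^ 2 * (2 * P.yz - (2 - q) * P.uy) * S.yz +
        (1 - q) * q * P.xv * S.xv + (1 - q) ^ 2 * (P.zv - P.xy) * S.xy) +
    F.zac * F.zab * ((1 - q) * P.xv * S.xv - (1 - q) * (2 - q) * P.uv * S.uv + (1 - q) ^ 2 * (2 - q) * (P.uy - P.yz) * S.uy +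
        (1 - q) ^ 2 * (P.zv - P.xy) * S.xy + (1 - q) ^ 2 * P.yz * S.yz) +
    F.z1 * F.z0 * ((1 - q) * (P.zv - (2 - q) * P.uv + (1 - q) * P.xy) * S.zv - (1 - q) * (2 - q) * (P.zv - (2 - q) * P.uv) * S.uv +
        (1 - q) ^ 2 * (P.yz - (2 - q) * P.uy) * S.yz - (1 - q) ^ 2 * P.xv * S.xv) +
    F.zab * F.zbc * ((1 - q) * (P.zv - (2 - q) * P.uv + (1 - q) * P.xy) * S.zv + (1 - q) ^ 2 * ((2 - q) * P.uy - P.yz) * S.yz +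
        (1 - q) ^ 2 * P.xv * S.xv - (1 - q) ^ 2 * (2 - q) * P.xy * S.uv)

/-- **`fanPhi q F u s = fanPhiP q F (uprods u) (sprods s)`.** [folklore] -/
theorem fanPhi_eq_P (q : ℝ) (F u s : V5) : fanPhi q F u s = fanPhiP q F (uprods u) (sprods s) := by
  simp only [fanPhi, fanPhiP, uprods, sprods]; ring

/-- Linearity in `P`: scalars. [folklore] -/
theorem fanPhiP_smul_left (q c : ℝ) (F : V5) (P S : P6) : fanPhiP q F (P6.smul c P) S = c * fanPhiP q F P S := by
  simp only [fanPhiP, P6.smul]; ring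

/-- Linearity in `P`: sums. [folklore] -/
theorem fanPhiP_add_left (q : ℝ) (F : V5) (P Q S : P6) : fanPhiP q F (P6.add P Q) S = fanPhiP q F P S + fanPhiP q F Q S := by
  simp only [fanPhiP, P6.add]; ring

/-- Linearity in `S`: scalars. [folklore] -/
theorem fanPhiP_smul_right (q c : ℝ) (F : V5) (P S : P6) : fanPhiP q F P (P6.smul c S) = c * fanPhiP q F P S := by
  simp only [fanPhiP, P6.smul]; ring

/-- Linearity in `S`: sums. [folklore] -/
theorem fanPhiP_add_right (q : ℝ) (F : V5) (P S T : P6) : fanPhiP q F P (P6.add S T) = fanPhiP q F P S + fanPhiP q F P T := by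
  simp only [fanPhiP, P6.add]; ring

/-! ### The endpoint product vectors of a leg -/

/-- Ray `A = e_{xv}` (only `Z_ab`-mass). [folklore] -/
def rayA : P6 := ⟨0, 1, 0, 0, 0, 0⟩
/-- Ray `D = e_{zv}` (only `Z_bc`-mass). [folklore] -/
def rayD : P6 := ⟨0, 0, 0, 0, 1, 0⟩
/-- Ray `AC = e_{xv} + e_{xy}` (infinitesimal `Z_ab` against `Z_ac`). [folklore] -/
def rayAC : P6 := ⟨0, 1, 0, 1, 0, 0⟩
/-- Ray `BD = e_{yz} + e_{zv}` (infinitesimal `Z_bc` against `Z_ac`). [folklore] -/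
def rayBD : P6 := ⟨0, 0, 1, 0, 1, 0⟩
/-- Ray `𝟙` (all products equal: the vector `δ₀`). [folklore] -/
def rayOne : P6 := ⟨1, 1, 1, 1, 1, 1⟩

/-- The roof product vector per unit `κl`: with `u₀ = u₀(t,w)`, `xw`, `zw` of `…OneSidedRays`,
`(u₀(1+t), (u₀+xw)(1+t), t(u₀+zw), t(u₀+xw), (u₀+zw)(1+t), t u₀)`. [folklore] -/
def roofP (q t w : ℝ) : P6 :=
  ⟨u0R q t w * (1 + t), (u0R q t w + xwR q w) * (1 + t), t * (u0R q t w + zwR q w), t * (u0R q t w + xwR q w),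
    (u0R q t w + zwR q w) * (1 + t), t * u0R q t w⟩

/-- **Degenerate frame**: `uprods (vecB q (qy) y 0 0 u₀) = (u₀y)·𝟙`. [folklore] -/
theorem uprods_deg (q y u0 : ℝ) : uprods (vecB q (q * y) y 0 0 u0) = P6.smul (u0 * y) rayOne := by
  ext <;> simp only [uprods, vecB, P6.smul, rayOne, hx, hy, hz, V5.total] <;> ring

/-- **Floor point**: `uprods (vecB q W y X Z 0) = X(W−qy)·A + Xy·AC + Z(W−qy)·D + Zy·BD`. [folklore] -/
theorem uprods_floor (q W y X Z : ℝ) :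
    uprods (vecB q W y X Z 0) =
      P6.add (P6.add (P6.smul (X * (W - q * y)) rayA) (P6.smul (X * y) rayAC))
        (P6.add (P6.smul (Z * (W - q * y)) rayD) (P6.smul (Z * y) rayBD)) := by
  ext <;> simp only [uprods, vecB, P6.smul, P6.add, rayA, rayAC, rayD, rayBD, hx, hy, hz, V5.total] <;> ring

/-- **Roof point**: `uprods (roofV q κ l t w) = κl·roofP q t w`. [folklore] -/
theorem uprods_roofV (q κ l t w : ℝ) : uprods (roofV q κ l t w) = P6.smul (κ * l) (roofP q t w) := by
  ext <;> simp only [uprods, roofV, vecB, P6.smul, roofP, u0R, xwR, zwR, hx, hy, hz, V5.total] <;> ring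

/-! ### The fan leg: bilinear building blocks and the three shapes -/

/-- The master form in product coordinates: `N(P) = zv − (2−q)uv + (1−q)xy` (`= N^{(bc)}(u)` for `P = uprods u`, `= N^{(ac)}(s)` for
`P = sprods s`). [folklore] -/
def nform (q : ℝ) (P : P6) : ℝ := P.zv - (2 - q) * P.uv + (1 - q) * P.xy

/-- `A(P,S) = xv·xv' + (1−q)yz·yz' − (2−q)uv·uv'` (coefficient of `f_ac²`, the `N^{(ab)}(u∗s)`-type form). [folklore] -/
def condA (q : ℝ) (P S : P6) : ℝ := P.xv * S.xv + (1 - q) * P.yz * S.yz - (2 - q) * P.uv * S.uv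

/-- `N(P)·(ŷ'v̂')` (coefficient of `f_bc²`). [folklore] -/
def condN (q : ℝ) (P S : P6) : ℝ := nform q P * S.zv

/-- Coefficient of `f_ac f_ab`. [folklore] -/
def condC1 (q : ℝ) (P S : P6) : ℝ :=
  (1 - q) * P.xv * S.xv - (1 - q) * (2 - q) * P.uv * S.uv + (1 - q) ^ 2 * (2 - q) * (P.uy - P.yz) * S.uy +
    (1 - q) ^ 2 * (P.zv - P.xy) * S.xy + (1 - q) ^ 2 * P.yz * S.yz

/-- Coefficient of `f_ab f_bc`. [folklore] -/
def condC2 (q : ℝ) (P S : P6) : ℝ :=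
  (1 - q) * nform q P * S.zv + (1 - q) ^ 2 * ((2 - q) * P.uy - P.yz) * S.yz + (1 - q) ^ 2 * P.xv * S.xv -
    (1 - q) ^ 2 * (2 - q) * P.xy * S.uv

/-- Coefficient of `f₁ f₀` (the only sign-indefinite Gram entry). [folklore] -/
def condC10 (q : ℝ) (P S : P6) : ℝ :=
  (1 - q) * nform q P * S.zv - (1 - q) * (2 - q) * (P.zv - (2 - q) * P.uv) * S.uv + (1 - q) ^ 2 * (P.yz - (2 - q) * P.uy) * S.yz -
    (1 - q) ^ 2 * P.xv * S.xv

/-- `Φ_X = (1−q)·condN + t·condC2` (value of the fan direction `e_X`). [folklore] -/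
def phiX (q t : ℝ) (P S : P6) : ℝ := (1 - q) * condN q P S + t * condC2 q P S

/-- `Φ_Z = (1−q)·condA + t·condC1` (value of the fan direction `e_Z`). [folklore] -/
def phiZ (q t : ℝ) (P S : P6) : ℝ := (1 - q) * condA q P S + t * condC1 q P S

/-- `Φ₀ = t(1−q)N(P)N(S) + condC10` (value of the fan fibre direction `e₀`). [folklore] -/
def phi0 (q t : ℝ) (P S : P6) : ℝ := t * (1 - q) * nform q P * nform q S + condC10 q P S

/-- **The roof functional of the fan leg** (per unit `κl`): `xw(w)·Φ_X + zw(w)·Φ_Z + u₀(t,w)·Φ₀`. [folklore] -/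
def roofF (q t w : ℝ) (P S : P6) : ℝ := xwR q w * phiX q t P S + zwR q w * phiZ q t P S + u0R q t w * phi0 q t P S

/-- The degenerate fan vector: `swapAC (swapAB (vecB q (qy) y 0 0 u₀)) = (u₀, y−u₀, 0, 0, 0)`. [folklore] -/
theorem fanVec_deg (q y u0 : ℝ) : swapAC (swapAB (vecB q (q * y) y 0 0 u0)) = ⟨u0, y - u0, 0, 0, 0⟩ := by
  ext <;> simp [swapAC, swapAB, vecB]

/-- The floor fan vector: `swapAC (swapAB (vecB q W y X Z 0)) = (0, y, Z, X, W−qy−X−Z)`. [folklore] -/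
theorem fanVec_floor (q W y X Z : ℝ) : swapAC (swapAB (vecB q W y X Z 0)) = ⟨0, y, Z, X, W - q * y - X - Z⟩ := by
  ext <;> simp [swapAC, swapAB, vecB]

/-- **Degenerate fan vector**: `fanPhiP q (f₀, f_ab, 0, 0, 0) P S = (1−q)·N(P)·N(S)·(f₀² + f₀f_ab)`. [folklore] -/
theorem fanPhiP_degF (q f0 fab : ℝ) (P S : P6) :
    fanPhiP q ⟨f0, fab, 0, 0, 0⟩ P S = (1 - q) * nform q P * nform q S * (f0 ^ 2 + f0 * fab) := by
  simp only [fanPhiP, nform]; ring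

/-- **Floor fan vector**: the decomposition over `condA, condN, condC1, condC2`. [folklore] -/
theorem fanPhiP_floorF (q fab fac fbc f1 : ℝ) (P S : P6) :
    fanPhiP q ⟨0, fab, fac, fbc, f1⟩ P S =
      (1 - q) * condA q P S * (fac ^ 2 + fac * f1 + fac * fbc) + (1 - q) * condN q P S * (fbc ^ 2 + f1 * fbc + fac * fbc) +
        fac * fab * condC1 q P S + fab * fbc * condC2 q P S := by
  simp only [fanPhiP, condA, condN, condC1, condC2, nform]; ring

/-- **Roof fan vector**: `fanPhiP q (swapAC (swapAB (roofV q κ l t w))) P S = κl·roofF q t w P S`. [folklore] -/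
theorem fanPhiP_roofF (q κ l t w : ℝ) (P S : P6) :
    fanPhiP q (swapAC (swapAB (roofV q κ l t w))) P S = κ * l * roofF q t w P S := by
  simp only [fanPhiP, roofF, phiX, phiZ, phi0, condA, condN, condC1, condC2, condC10, nform, swapAC, swapAB, roofV, vecB,
    xwR, zwR, u0R]
  ring

/-- Floor fan vectors are `≥ 0` once the four bilinear forms are. [folklore] -/
theorem fanPhiP_floorF_nonneg {q : ℝ} (hq1 : q ≤ 1) {P S : P6} (hA : 0 ≤ condA q P S) (hN : 0 ≤ condN q P S)
    (hC1 : 0 ≤ condC1 q P S) (hC2 : 0 ≤ condC2 q P S) {fab fac fbc f1 : ℝ} (hfab : 0 ≤ fab) (hfac : 0 ≤ fac) (hfbc : 0 ≤ fbc)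
    (hf1 : 0 ≤ f1) : 0 ≤ fanPhiP q ⟨0, fab, fac, fbc, f1⟩ P S := by
  rw [fanPhiP_floorF]
  have := sub_nonneg.2 hq1
  positivity

/-- Degenerate fan vectors are `≥ 0` once `N(P)·N(S) ≥ 0`. [folklore] -/
theorem fanPhiP_degF_nonneg {q : ℝ} (hq1 : q ≤ 1) {P S : P6} (hNN : 0 ≤ nform q P * nform q S) {f0 fab : ℝ}
    (hf0 : 0 ≤ f0) (hfab : 0 ≤ fab) : 0 ≤ fanPhiP q ⟨f0, fab, 0, 0, 0⟩ P S := by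
  rw [fanPhiP_degF]
  have h1 : 0 ≤ f0 ^ 2 + f0 * fab := by positivity
  have h2 := mul_nonneg (mul_nonneg (sub_nonneg.2 hq1) hNN) h1
  calc (0:ℝ) ≤ (1 - q) * (nform q P * nform q S) * (f0 ^ 2 + f0 * fab) := h2
    _ = _ := by ring

/-! ### The target condition on a pair of product vectors -/

/-- **`GoodPS q P S`**: the fan-leg conditions at the pair `(P, S)` — floor (`condA, condN, condC1, condC2 ≥ 0`), degenerate (`N(P)N(S) ≥ 0`) and
roof (`roofF q t w P S ≥ 0` for `t ≥ 0`, `w ∈ [0,1]`). [folklore] -/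
def GoodPS (q : ℝ) (P S : P6) : Prop :=
  0 ≤ condA q P S ∧ 0 ≤ condN q P S ∧ 0 ≤ condC1 q P S ∧ 0 ≤ condC2 q P S ∧ 0 ≤ nform q P * nform q S ∧
    ∀ t w : ℝ, 0 ≤ t → 0 ≤ w → w ≤ 1 → 0 ≤ roofF q t w P S

end ThreeApex

end FK

end Summit.CriticalPhenomena.PercolationContinuityZ3.Theorems
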